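import Summits.HodgeConjecture.HodgeConjecture.Theorems.H413CuspCotClassMap
import Summits.HodgeConjecture.HodgeConjecture.Theorems.P4StubT1ArchFactor
import Literature.NumberTheory.Automorphic.UnitaryGroupCohomologicalForms
import Literature.NumberTheory.Automorphic.AdelicUnitaryGroupSpectrum
import Literature.NumberTheory.Automorphic.UnitaryGroupAdelicProduct
import Literature.NumberTheory.Automorphic.UnitaryGroupArchSection
import Literature.NumberTheory.Automorphic.UnitaryGroupArchProjectionEmb
import Literature.AlgebraicGeometry.ShimuraVarieties.UnitaryBallHolomorphyCriterion
import Literature.Geometry.ComplexHyperbolic.UnitBallJacobian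
import Mathlib.MeasureTheory.Function.LpSpace.Indicator
import Mathlib.LinearAlgebra.Basis.VectorSpace
import HarnessLib

/-!
# FLOOR-0 programme P2, stub U2ℓ CLOSED: the `(1,0) ⊕ (0,1)` cotangent automorphic forms of `U(V)` are CONTINUOUS on `U(V)(𝔸_{F⁺})`,
# descend to continuous functions on the compact quotient `U(V)(F⁺)\U(V)(𝔸_{F⁺})`, and are realised `ℂ`-linearly in `L²(μ)`

Cell hodgecm-mathlib (D-0151), FLOOR 0; crux item H413 = stmt-HodgeConjecture-24833; sub-line `Cruxes/H413/Lines/F0_P2CohSpectrumL2.lean`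
(F0P2-plan (g0), registrar cut v1.1 b83be997), registered stub `stub_U2l_l2Realisation : StubU2lL2Realisation` (:532), i.e.

  `∃ (μ automorphic) (ℓ : X →ₗ[ℂ] (Fin 2 → L²(μ))), Represents F V (archFactorOf F V) μ ℓ`,

`Represents 𝔞 μ ℓ := ∀ f ∈ cohForms 𝔞, ∀ k, ∃ φ : C(U(V)(F⁺)\U(V)(𝔸), ℂ), (∀ h, φ [h] = f h⁻¹ k) ∧ ℓ f k =ᵐ[μ] φ` (§2b of the line).  Seat F0P2-p01
(g0).  THIS FILE PROVES IT in the unfolded, binder-minimal form `exists_isAutomorphicMeasure_represents F h4 V` (only `4 ≤ [F:ℚ]` of the face's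
binders is used); the by-name fold at the face is the one-line `fun hDel F _ h6 _ V a₀ Φ hΦ i => exists_isAutomorphicMeasure_represents F (h6-bound) V`
over the shared module `Theorems/H413SpectrumInterfaces.lean` once it is in the tree (the Lines workfile is not importable).

THE MATHEMATICAL POINT (the planner's card took it for granted; the tree's `weightForms` is purely ALGEBRAIC — it has no continuity conjunct):
a holomorphic cotangent form `f ∈ holCotForms 𝔞₀` (`𝔞₀ = archFactorOf F V`) is continuous on the adelic group.  Proof:
* §1 (any factor `𝔞`) every `U(2,1)`-slice `u ↦ f (x · ιinf u)` is a weight form on `U(2,1)` for the cotangent cocycle with holomorphic germs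
  (`IsHolGerm`), hence by the tree's first-order Cauchy–Riemann criterion ★ `BallForms.mem_holWeightForms_of_differentiableAt` it is the group function
  `u ↦ ᵗJac(u, x₀) · F(u · x₀)` of a HOLOMORPHIC (so continuous, ★ `BallForms.continuous_of_mem_holomorphic`) `F` on the ball, continuous by ★
  `continuous_toGroupFun_matrixCocycle` ([Borel1997, §5.14]; [Bump1997, §2.1, §3.2] for the `SL₂` prototype);
* §2 (factor of record) `f x = f ((1, x_f) · ιinf (pr_{ι₁} x_∞))` by right `K_c`-invariance (★ `UnitaryGroupAdelicProduct`: `x = (x_∞,1)(1,x_f)`,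
  ★ `archProjU21EmbCM`, ★ `P4StubT1ArchFactor.archFactorOf_isHonest`), and `f` is right-invariant under an OPEN `K_f ≤ U(V)(𝔸_{F⁺,f})`
  (★ `CuspCot.exists_isOpen_forall_rightRep_eq`), so near `x` the form is a continuous slice composed with the continuous projection
  `y ↦ pr_{ι₁}(y_∞)` — continuity on `U(V)(𝔸_{F⁺})` ([BorelJacquet1979, §4.1–4.2]; [PlatonovRapinchuk1994, §5.1]); `cohForms = hol ⊕ conj hol`.
* §3 descent: left `U(V)(F⁺)`-invariance (`A_G = 1` for the unitary datum) makes ★ `CotangentForms.toQuotFun` (`[g] ↦ f(g⁻¹) k`, F0-typ1's junction)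
  a CONTINUOUS function on the quotient, which is COMPACT for the anisotropic `Hm V` (★ `compactSpace_cmDatum_automorphicQuotient`, Godement;
  anisotropy from `4 ≤ [F:ℚ]`, ★ `HermSpace3.isAnisotropic`), hence in `L²` of the finite automorphic measure ([Borel1963, §5]);
* §4 `ℓ f k := MemLp.toLp (toQuotFun (f · k))` is `ℂ`-linear on the submodule where these classes exist and extends to all of `X` (Mathlib
  `LinearMap.exists_extend`); the automorphic `μ` is ★ `exists_isAutomorphicMeasure_cmDatum`.
Public by-products for the junction lemmas J1–J3 of the line (seats p02/p03): `continuous_of_mem_cohForms`, `continuous_toQuotFun`, `memLp_toQuotFun`,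
and the STRONG form `exists_linearMap_toLp` (`ℓ f k = toLp (toQuotFun (f · k))` on `cohForms 𝔞₀`, for EVERY automorphic `μ`).

THEOREMS ONLY (no `def`, no `sorry`, no named-fact hypothesis).  HC_CM is proved only modulo the 7 printed citations until rung 0 closes; this file
discharges none of them.

## References
* [BorelJacquet1979] A. Borel, H. Jacquet, Corvallis PSPM 33.1, §4.1–4.2, §4.6.  [Borel1963] A. Borel, *Some finiteness properties of adele groups*, §5.
* [Borel1997] A. Borel, *Automorphic forms on SL₂(ℝ)*, §5.14.  [Bump1997] D. Bump, *Automorphic Forms and Representations*, §2.1, §3.2.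
* [PlatonovRapinchuk1994] §3.2 Thm. 3.1, §5.1.  [GelfandGraevPiatetskiShapiro1969] Ch. 1 §2.3 (compact quotient).
* Tree: ★ `Theorems/H413CohFormsCarriers` (carriers), ★ `Theorems/P4StubT1ArchFactor` (`archFactorOf_isHonest`), ★ `Theorems/H413CuspCotClassMap`
  (`exists_isOpen_forall_rightRep_eq`), ★ `Automorphic/UnitaryGroupCohomologicalForms` (`toQuotFun`, `toQuotFun_mk`), ★ `Automorphic/UnitaryGroupAdelicProduct`,
  `UnitaryGroupArchSection`, `UnitaryGroupArchProjectionEmb`, `AdelicUnitaryGroupMeasure`/`Spectrum`, ★ `ShimuraVarieties/UnitaryBallHolomorphyCriterion`,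
  `UnitaryBallAutomorphicForms`, ★ `ComplexHyperbolic/UnitBallJacobian`, ★ `Automorphic/AutomorphyFactorForms`.
-/

set_option autoImplicit false
set_option linter.dupNamespace false

noncomputable section

namespace Summit.HodgeConjecture.HodgeConjecture.Cruxes.H413.P2StubU2lL2Realisation

open MeasureTheory NumberField MulAction Topology Filter
open Literature.NumberTheory.Automorphic
open Literature.NumberTheory.Automorphic.UnitaryGroup
open Literature.NumberTheory.Automorphic.AutomorphyFactor
open Literature.AlgebraicGeometry.ShimuraVarieties
open Literature.Geometry.ComplexHyperbolic.BallModel (U21 x₀ Ball continuous_Jac_transpose)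
open Summit.HodgeConjecture.HodgeConjecture.Cruxes.H413.CohFormsCarriers

variable (F : HodgeCM.CMField) {ι₁ : F →+* ℂ} (V : HodgeCM.HermSpace3 F ι₁)

/-! ## §1 `U(2,1)`-slices of a weight form with holomorphic germs are continuous (any archimedean factor) -/

/-- **A `U(2,1)`-slice of a cotangent weight form with holomorphic germs is continuous.**  For any factor `𝔞`, any `f` of right `K_∞`-type the
cotangent isotropy representation along `𝔞.ιinf` with holomorphic germs along `𝔞.ιinf`, and any base point `x ∈ U(V)(𝔸_{F⁺})`, the slice
`u ↦ f (x · 𝔞.ιinf u)` is the group function of a holomorphic `ℂ²`-valued function on the ball (first-order Cauchy–Riemann criterion), hence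
continuous. [cite: Borel1997, §5.14] [cite: Bump1997, §3.2] -/
theorem continuous_slice (𝔞 : ArchFactor F V) {f : (adelicDatum F V).Adelic → (Fin 2 → ℂ)}
    (hW : f ∈ weightForms (adelicDatum F V).toAdelic.range (𝔞.ιinf.comp (stabilizer (↥U21) x₀).subtype)
      (BallForms.isPullbackCocycle_cotangentCocycle.weightOf x₀))
    (hH : HodgeCM.Model.IsHolGerm 𝔞.ιinf f) (x : (adelicDatum F V).Adelic) :
    Continuous fun u : ↥U21 => f (x * 𝔞.ιinf u) := by
  -- the slice is a weight form on `U(2,1)` for the trivial arithmetic group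
  set fx : ↥U21 → (Fin 2 → ℂ) := fun u => f (x * 𝔞.ιinf u) with hfx_def
  have hfx : fx ∈ weightForms (⊥ : Subgroup ↥U21) (stabilizer (↥U21) x₀).subtype
      (BallForms.isPullbackCocycle_cotangentCocycle.weightOf x₀) := by
    refine ⟨fun γ hγ u => ?_, fun k u => ?_⟩
    · rw [Subgroup.mem_bot] at hγ
      rw [hγ, one_mul]
    · show f (x * 𝔞.ιinf (u * (k : ↥U21))) = _
      rw [map_mul, ← mul_assoc]
      exact hW.2 k (x * 𝔞.ιinf u)
  -- holomorphic germs along `ιinf` = the Cauchy–Riemann hypotheses of the criterion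
  have hgerm : ∀ g : ↥U21, (fun b : Fin 2 → ℂ => fx (g * BallForms.expP b)) = HodgeCM.Model.germAt 𝔞.ιinf f (x * 𝔞.ιinf g) := by
    intro g
    funext b
    simp only [hfx_def, HodgeCM.Model.germAt, map_mul, mul_assoc]
  have hmem := BallForms.mem_holWeightForms_of_differentiableAt (Δ := (⊥ : Subgroup ↥U21)) ⟨fx, hfx⟩
    (fun g => by
      show DifferentiableAt ℝ (fun b : Fin 2 → ℂ => fx (g * BallForms.expP b)) 0
      rw [hgerm g]; exact hH.1 _)
    (fun g v => by
      show fderiv ℝ (fun b : Fin 2 → ℂ => fx (g * BallForms.expP b)) 0 (Complex.I • v) =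
        Complex.I • fderiv ℝ (fun b : Fin 2 → ℂ => fx (g * BallForms.expP b)) 0 v
      rw [hgerm g]; exact hH.2 _ v)
  -- unpack: the slice is the group function of a holomorphic function on the ball
  obtain ⟨Fb, hFb, hFbeq⟩ := Submodule.mem_map.1 hmem
  have hhol : ((Fb : factorForms (⊥ : Subgroup ↥U21) BallForms.cotangentCocycle) : Ball → (Fin 2 → ℂ)) ∈
      BallForms.holomorphic (Fin 2 → ℂ) :=
    (BallForms.mem_holFactorForms_iff.1 (Submodule.mem_comap.1 hFb)).2
  have hcont : Continuous (toGroupFun (matrixCocycle fun g z => (Literature.Geometry.ComplexHyperbolic.BallModel.Jac g z).transpose) x₀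
      ((Fb : factorForms (⊥ : Subgroup ↥U21) BallForms.cotangentCocycle) : Ball → (Fin 2 → ℂ))) :=
    continuous_toGroupFun_matrixCocycle (continuous_Jac_transpose x₀) (BallForms.continuous_of_mem_holomorphic hhol)
  have hval : fx = toGroupFun BallForms.cotangentCocycle x₀
      ((Fb : factorForms (⊥ : Subgroup ↥U21) BallForms.cotangentCocycle) : Ball → (Fin 2 → ℂ)) :=
    (congrArg Subtype.val hFbeq).symm
  show Continuous fx
  rw [hval]
  exact hcont

/-! ## §2 Continuity on `U(V)(𝔸_{F⁺})` at the factor of record -/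

/-- `range ιinf ≤ range archToAdelic` for the factor of record (clause (7) of its honesty). [cite: BorelJacquet1979, §4.1] -/
theorem ιinf_mem_range_archToAdelic (u : ↥U21) : (archFactorOf F V).ιinf u ∈ (archToAdelic' F V).range := by
  obtain ⟨_, _, _, _, _, _, hrange⟩ := P4StubT1ArchFactor.archFactorOf_isHonest F V
  rw [← hrange]
  exact Subgroup.mem_sup_left ⟨u, rfl⟩

/-- The finite-adelic component of `ιinf u` is trivial. [cite: BorelJacquet1979, §4.1] -/
theorem finPart_ιinf (u : ↥U21) :
    finPart (↥(maximalRealSubfield (HodgeCM.CMField.K F))) (HodgeCM.CMField.K F) (IsCMField.complexConj (HodgeCM.CMField.K F)) 3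
      (HodgeCM.HermSpace3.Hm V) ((archFactorOf F V).ιinf u) = 1 := by
  obtain ⟨a, ha⟩ := ιinf_mem_range_archToAdelic F V u
  rw [← ha]
  exact finPart_archToAdelic _ _ _ _ _ a

/-- `ιinf u = (its archimedean component, 1)`. [cite: BorelJacquet1979, §4.1] -/
theorem archToAdelic_archPart_ιinf (u : ↥U21) :
    archToAdelic' F V (archPart (↥(maximalRealSubfield (HodgeCM.CMField.K F))) (HodgeCM.CMField.K F)
      (IsCMField.complexConj (HodgeCM.CMField.K F)) 3 (HodgeCM.HermSpace3.Hm V) ((archFactorOf F V).ιinf u)) = (archFactorOf F V).ιinf u := by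
  have h := archToAdelic_mul_finAdelicToAdelic (↥(maximalRealSubfield (HodgeCM.CMField.K F))) (HodgeCM.CMField.K F)
    (IsCMField.complexConj (HodgeCM.CMField.K F)) 3 (HodgeCM.HermSpace3.Hm V) ((archFactorOf F V).ιinf u)
  rw [finPart_ιinf, map_one, mul_one] at h
  exact h

/-- **The `K_c`-part of an archimedean element.**  For `a ∈ U(V)(F⁺ ⊗ ℝ)`: `(a, 1) = ιinf (pr_{ι₁} a) · k` with `k` in the compact factor `K_c` of
the factor of record (the image of the kernel of the projection at `ι₁`). [cite: BorelJacquet1979, §4.1] [cite: PlatonovRapinchuk1994, §5.1] -/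
theorem exists_mem_Kc_archToAdelic_eq
    (a : ↥(arch (↥(maximalRealSubfield (HodgeCM.CMField.K F))) (HodgeCM.CMField.K F) (IsCMField.complexConj (HodgeCM.CMField.K F)) 3
      (HodgeCM.HermSpace3.Hm V))) :
    ∃ k ∈ (archFactorOf F V).Kc, archToAdelic' F V a =
      (archFactorOf F V).ιinf (archProjU21EmbCM (HodgeCM.CMField.K F) (HodgeCM.HermSpace3.Hm V) ι₁ V.sylvesterFrame
        (formCongr_eq_of_conjTranspose (HodgeCM.CMField.K F) ι₁ (HodgeCM.HermSpace3.Hm V) V.sylvesterFrame (HodgeCM.Model.sylvesterFrame_J V)) a) * k := by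
  refine ⟨archToAdelic' F V ((archPart (↥(maximalRealSubfield (HodgeCM.CMField.K F))) (HodgeCM.CMField.K F)
      (IsCMField.complexConj (HodgeCM.CMField.K F)) 3 (HodgeCM.HermSpace3.Hm V) ((archFactorOf F V).ιinf
        (archProjU21EmbCM (HodgeCM.CMField.K F) (HodgeCM.HermSpace3.Hm V) ι₁ V.sylvesterFrame
          (formCongr_eq_of_conjTranspose (HodgeCM.CMField.K F) ι₁ (HodgeCM.HermSpace3.Hm V) V.sylvesterFrame (HodgeCM.Model.sylvesterFrame_J V))
          a)))⁻¹ * a), ?_, ?_⟩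
  · rw [archFactorOf_Kc]
    refine Subgroup.mem_map_of_mem _ ?_
    have hps : archProjU21EmbCM (HodgeCM.CMField.K F) (HodgeCM.HermSpace3.Hm V) ι₁ V.sylvesterFrame
        (formCongr_eq_of_conjTranspose (HodgeCM.CMField.K F) ι₁ (HodgeCM.HermSpace3.Hm V) V.sylvesterFrame (HodgeCM.Model.sylvesterFrame_J V))
        (archPart (↥(maximalRealSubfield (HodgeCM.CMField.K F))) (HodgeCM.CMField.K F) (IsCMField.complexConj (HodgeCM.CMField.K F)) 3
          (HodgeCM.HermSpace3.Hm V) ((archFactorOf F V).ιinf (archProjU21EmbCM (HodgeCM.CMField.K F) (HodgeCM.HermSpace3.Hm V) ι₁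
            V.sylvesterFrame (formCongr_eq_of_conjTranspose (HodgeCM.CMField.K F) ι₁ (HodgeCM.HermSpace3.Hm V) V.sylvesterFrame
              (HodgeCM.Model.sylvesterFrame_J V)) a))) =
        archProjU21EmbCM (HodgeCM.CMField.K F) (HodgeCM.HermSpace3.Hm V) ι₁ V.sylvesterFrame
          (formCongr_eq_of_conjTranspose (HodgeCM.CMField.K F) ι₁ (HodgeCM.HermSpace3.Hm V) V.sylvesterFrame (HodgeCM.Model.sylvesterFrame_J V)) a :=
      archProjU21EmbCM_archPart_archSectionU21CM (HodgeCM.CMField.K F) ι₁ (HodgeCM.HermSpace3.Hm V) V.sylvesterFrame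
        (HodgeCM.Model.sylvesterFrame_J V) _
    rw [MonoidHom.mem_ker, map_mul, map_inv, hps, inv_mul_cancel]
  · rw [map_mul, map_inv, archToAdelic_archPart_ιinf, mul_inv_cancel_left]

/-- **Slice decomposition at the factor of record.**  For a right `K_c`-invariant `f` and every `x ∈ U(V)(𝔸_{F⁺})`:
`f x = f ((1, x_f) · ιinf (pr_{ι₁} x_∞))` — the archimedean component factors as `ιinf (pr x_∞)` times an element of the compact factor `K_c`,
which commutes past `(1, x_f)` and `ιinf` and is absorbed by `f`. [cite: BorelJacquet1979, §4.1] [cite: PlatonovRapinchuk1994, §5.1] -/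
theorem apply_eq_apply_slice {f : (adelicDatum F V).Adelic → (Fin 2 → ℂ)} (hK : ∀ k ∈ (archFactorOf F V).Kc, ∀ x, f (x * k) = f x)
    (x : (adelicDatum F V).Adelic) :
    f x = f (finToAdelic F V (finPart (↥(maximalRealSubfield (HodgeCM.CMField.K F))) (HodgeCM.CMField.K F)
        (IsCMField.complexConj (HodgeCM.CMField.K F)) 3 (HodgeCM.HermSpace3.Hm V) x) *
      (archFactorOf F V).ιinf (archProjU21EmbCM (HodgeCM.CMField.K F) (HodgeCM.HermSpace3.Hm V) ι₁ V.sylvesterFrame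
        (formCongr_eq_of_conjTranspose (HodgeCM.CMField.K F) ι₁ (HodgeCM.HermSpace3.Hm V) V.sylvesterFrame (HodgeCM.Model.sylvesterFrame_J V))
        (archPart (↥(maximalRealSubfield (HodgeCM.CMField.K F))) (HodgeCM.CMField.K F) (IsCMField.complexConj (HodgeCM.CMField.K F)) 3
          (HodgeCM.HermSpace3.Hm V) x))) := by
  obtain ⟨_, _, _, hcommF, hcommKF, _, _⟩ := P4StubT1ArchFactor.archFactorOf_isHonest F V
  obtain ⟨k, hk, hdec⟩ := exists_mem_Kc_archToAdelic_eq F V (archPart (↥(maximalRealSubfield (HodgeCM.CMField.K F))) (HodgeCM.CMField.K F)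
    (IsCMField.complexConj (HodgeCM.CMField.K F)) 3 (HodgeCM.HermSpace3.Hm V) x)
  have hx := (archToAdelic_mul_finAdelicToAdelic (↥(maximalRealSubfield (HodgeCM.CMField.K F))) (HodgeCM.CMField.K F)
    (IsCMField.complexConj (HodgeCM.CMField.K F)) 3 (HodgeCM.HermSpace3.Hm V) x).symm
  rw [show archToAdelic (↥(maximalRealSubfield (HodgeCM.CMField.K F))) (HodgeCM.CMField.K F)
    (IsCMField.complexConj (HodgeCM.CMField.K F)) 3 (HodgeCM.HermSpace3.Hm V) = archToAdelic' F V from rfl, hdec, mul_assoc,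
    hcommKF k hk, ← mul_assoc, hcommF] at hx
  rw [congrArg f hx]
  exact hK k hk _

/-- **Holomorphic cotangent forms for the factor of record are continuous on `U(V)(𝔸_{F⁺})`.** [cite: BorelJacquet1979, §4.1–4.2]
[cite: Borel1997, §5.14] -/
theorem continuous_of_mem_holCotForms {f : (adelicDatum F V).Adelic → (Fin 2 → ℂ)} (hf : f ∈ holCotForms (archFactorOf F V)) :
    Continuous f := by
  -- notation
  set K := HodgeCM.CMField.K F
  set Fp : Type := ↥(maximalRealSubfield K)
  set c := IsCMField.complexConj K
  set H := HodgeCM.HermSpace3.Hm V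
  set hT := formCongr_eq_of_conjTranspose K ι₁ H V.sylvesterFrame (HodgeCM.Model.sylvesterFrame_J V)
  set proj := archProjU21EmbCM K H ι₁ V.sylvesterFrame hT with hproj
  obtain ⟨⟨⟨hW, hK⟩, hS⟩, hH⟩ := hf
  obtain ⟨Kf, hKo, hKf⟩ := CuspCot.exists_isOpen_forall_rightRep_eq hS
  obtain ⟨_, _, _, hcommF, _, _, _⟩ := P4StubT1ArchFactor.archFactorOf_isHonest F V
  have hP : Continuous fun y : (adelicDatum F V).Adelic => proj (archPart Fp K c 3 H y) :=
    (continuous_archProjU21EmbCM K H ι₁ V.sylvesterFrame hT).comp (continuous_archPart Fp K c 3 H)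
  refine continuous_iff_continuousAt.2 fun x => ?_
  -- the continuous candidate near `x`: the slice through `(1, x_f)` composed with `y ↦ pr (y_∞)`
  have hslice := continuous_slice F V (archFactorOf F V) hW hH (finToAdelic F V (finPart Fp K c 3 H x))
  have hN : ∀ᶠ y in 𝓝 x, finPart Fp K c 3 H (x⁻¹ * y) ∈ Kf := by
    have hc : Continuous fun y : (adelicDatum F V).Adelic => finPart Fp K c 3 H (x⁻¹ * y) :=
      (continuous_finPart Fp K c 3 H).comp (continuous_const.mul continuous_id)
    refine hc.continuousAt.eventually_mem (hKo.mem_nhds ?_)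
    show finPart Fp K c 3 H (x⁻¹ * x) ∈ (Kf : Set ↥(HodgeCM.HermSpace3.adelicFin V))
    rw [inv_mul_cancel, map_one]
    exact Kf.one_mem
  have heq : (fun y => f (finToAdelic F V (finPart Fp K c 3 H x) * (archFactorOf F V).ιinf (proj (archPart Fp K c 3 H y)))) =ᶠ[𝓝 x] f := by
    filter_upwards [hN] with y hy
    rw [apply_eq_apply_slice F V hK y]
    have e : finPart Fp K c 3 H y = finPart Fp K c 3 H x * finPart Fp K c 3 H (x⁻¹ * y) := by
      rw [← map_mul, mul_inv_cancel_left]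
    have e2 : finToAdelic F V (finPart Fp K c 3 H y) * (archFactorOf F V).ιinf (proj (archPart Fp K c 3 H y)) =
        finToAdelic F V (finPart Fp K c 3 H x) * (archFactorOf F V).ιinf (proj (archPart Fp K c 3 H y)) *
          finToAdelic F V (finPart Fp K c 3 H (x⁻¹ * y)) := by
      rw [e, map_mul, mul_assoc, mul_assoc, hcommF]
    have hm : f (finToAdelic F V (finPart Fp K c 3 H x) * (archFactorOf F V).ιinf (proj (archPart Fp K c 3 H y)) *
          finToAdelic F V (finPart Fp K c 3 H (x⁻¹ * y))) =
        f (finToAdelic F V (finPart Fp K c 3 H x) * (archFactorOf F V).ιinf (proj (archPart Fp K c 3 H y))) :=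
      congrFun (hKf _ hy) _
    rw [e2, hm]
  exact (hslice.comp hP).continuousAt.congr heq

/-- **The `(1,0) ⊕ (0,1)` cohomological cotangent forms for the factor of record are continuous on `U(V)(𝔸_{F⁺})`** (`cohForms = hol ⊕ conj hol`,
conjugation is continuous). [cite: BorelWallach2000, VII 2.10] [cite: BorelJacquet1979, §4.2] -/
theorem continuous_of_mem_cohForms {f : (adelicDatum F V).Adelic → (Fin 2 → ℂ)} (hf : f ∈ cohForms (archFactorOf F V)) :
    Continuous f := by
  obtain ⟨f₁, hf₁, f₂, hf₂, rfl⟩ := Submodule.mem_sup.1 hf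
  obtain ⟨g, hg, rfl⟩ := Submodule.mem_map.1 hf₂
  have hg' : Continuous fun x => star (g x) := continuous_star.comp (continuous_of_mem_holCotForms F V hg)
  exact (continuous_of_mem_holCotForms F V hf₁).add hg'

/-! ## §3 Descent to the compact quotient `U(V)(F⁺)\U(V)(𝔸_{F⁺})` -/

/-- `A_G · U(V)(F⁺) = U(V)(F⁺)` inside `U(V)(𝔸_{F⁺})`: the unitary datum has `A_G = 1`. [cite: Borel1963, §5] -/
theorem quotientSubgroup_eq : (adelicDatum F V).quotientSubgroup = (adelicDatum F V).toAdelic.range := by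
  rw [AdelicGroupData.quotientSubgroup, AdelicGroupData.arithmeticSubgroup]
  show (⊥ : Subgroup (adelicDatum F V).Adelic) ⊔ _ = _
  exact bot_sup_eq _

variable {F V} in
/-- Cotangent forms (any factor) are LEFT-invariant under `A_G · U(V)(F⁺) = U(V)(F⁺)`. [cite: BorelJacquet1979, §4.2] -/
theorem apply_mul_left_of_mem_cohForms {𝔞 : ArchFactor F V} {f : (adelicDatum F V).Adelic → (Fin 2 → ℂ)} (hf : f ∈ cohForms 𝔞)
    {γ : (adelicDatum F V).Adelic} (hγ : γ ∈ (adelicDatum F V).quotientSubgroup) (g : (adelicDatum F V).Adelic) : f (γ * g) = f g := by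
  rw [quotientSubgroup_eq] at hγ
  obtain ⟨f₁, hf₁, f₂, hf₂, rfl⟩ := Submodule.mem_sup.1 hf
  obtain ⟨g', hg', rfl⟩ := Submodule.mem_map.1 hf₂
  have h1 : f₁ (γ * g) = f₁ g := hf₁.1.1.1.1 γ hγ g
  have h2 : g' (γ * g) = g' g := hg'.1.1.1.1 γ hγ g
  show f₁ (γ * g) + star (g' (γ * g)) = f₁ g + star (g' g)
  rw [h1, h2]

/-- **The descended coordinate function is `[h] ↦ f(h⁻¹) k`** (F0-typ1's junction ★ `CotangentForms.toQuotFun`, orientation matching `rightRep` with the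
tree's `rightRegular`). [cite: BorelJacquet1979, §4.2] -/
theorem toQuotFun_toAutomorphicQuotient {𝔞 : ArchFactor F V} {f : (adelicDatum F V).Adelic → (Fin 2 → ℂ)} (hf : f ∈ cohForms 𝔞)
    (k : Fin 2) (h : (adelicDatum F V).Adelic) :
    CotangentForms.toQuotFun (adelicDatum F V) (fun g => f g k) ((adelicDatum F V).toAutomorphicQuotient h) = f h⁻¹ k :=
  CotangentForms.toQuotFun_mk (fun γ hγ g => by simp only [apply_mul_left_of_mem_cohForms hf hγ g]) h

/-- **The descended coordinate functions of a cohomological cotangent form are CONTINUOUS on the quotient** (the quotient map is a quotient map and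
`h ↦ f(h⁻¹) k` is continuous). [cite: BorelJacquet1979, §4.2] -/
theorem continuous_toQuotFun {f : (adelicDatum F V).Adelic → (Fin 2 → ℂ)} (hf : f ∈ cohForms (archFactorOf F V)) (k : Fin 2) :
    Continuous (CotangentForms.toQuotFun (adelicDatum F V) fun g => f g k) := by
  have hq : IsQuotientMap (adelicDatum F V).toAutomorphicQuotient := QuotientGroup.isQuotientMap_mk _
  rw [hq.continuous_iff]
  have e : (CotangentForms.toQuotFun (adelicDatum F V) fun g => f g k) ∘ (adelicDatum F V).toAutomorphicQuotient = fun h => f h⁻¹ k :=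
    funext fun h => toQuotFun_toAutomorphicQuotient F V hf k h
  rw [e]
  exact ((continuous_apply k).comp (continuous_of_mem_cohForms F V hf)).comp continuous_inv

/-- **The descended coordinate functions are in `L²(μ)`** for every finite measure `μ` on the quotient, which is COMPACT for the anisotropic `Hm V`
(Godement's criterion, ★ `compactSpace_cmDatum_automorphicQuotient`). [cite: Borel1963, §5] [cite: GelfandGraevPiatetskiShapiro1969, Ch. 1 §2.3] -/
theorem memLp_toQuotFun (hV : HodgeCM.IsAnisotropic F (HodgeCM.HermSpace3.Hm V)) {f : (adelicDatum F V).Adelic → (Fin 2 → ℂ)}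
    (hf : f ∈ cohForms (archFactorOf F V)) (k : Fin 2) (μ : Measure (adelicDatum F V).automorphicQuotient) [IsFiniteMeasure μ] :
    MemLp (CotangentForms.toQuotFun (adelicDatum F V) fun g => f g k) 2 μ := by
  haveI : CompactSpace (adelicDatum F V).automorphicQuotient :=
    compactSpace_cmDatum_automorphicQuotient (HodgeCM.CMField.K F) 3 (HodgeCM.HermSpace3.Hm V) hV
  exact (continuous_toQuotFun F V hf k).memLp_of_hasCompactSupport (HasCompactSupport.of_compactSpace _)

/-! ## §4 The `L²`-realisation `ℓ` -/

/-- **STRONG FORM — for EVERY automorphic (indeed every finite) measure `μ`: a `ℂ`-linear `ℓ : X →ₗ[ℂ] (Fin 2 → L²(μ))` with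
`ℓ f k = MemLp.toLp (toQuotFun (f · k))` for all `f ∈ cohForms 𝔞₀`** (linear on the submodule where the classes exist, extended by Mathlib's
`LinearMap.exists_extend`). [cite: BorelJacquet1979, §4.6] [cite: Borel1963, §5] -/
theorem exists_linearMap_toLp (hV : HodgeCM.IsAnisotropic F (HodgeCM.HermSpace3.Hm V))
    (μ : Measure (adelicDatum F V).automorphicQuotient) [IsFiniteMeasure μ] :
    ∃ ℓ : ((adelicDatum F V).Adelic → (Fin 2 → ℂ)) →ₗ[ℂ] (Fin 2 → (adelicDatum F V).L2 μ),
      ∀ f ∈ cohForms (archFactorOf F V), ∀ k : Fin 2,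
        ∃ hm : MemLp (CotangentForms.toQuotFun (adelicDatum F V) fun g => f g k) 2 μ,
          ℓ f k = MemLp.toLp (CotangentForms.toQuotFun (adelicDatum F V) fun g => f g k) hm := by
  -- the submodule of functions all of whose descended coordinate functions are `L²`
  let D : Submodule ℂ ((adelicDatum F V).Adelic → (Fin 2 → ℂ)) :=
    { carrier := {f | ∀ k : Fin 2, MemLp (CotangentForms.toQuotFun (adelicDatum F V) fun g => f g k) 2 μ}
      add_mem' := fun {f f'} hf hf' k => (hf k).add (hf' k)
      zero_mem' := fun k => MemLp.zero
      smul_mem' := fun r f hf k => (hf k).const_smul r }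
  -- `f ↦ (k ↦ toLp (toQuotFun (f · k)))` is linear on `D`
  let L₀ : D →ₗ[ℂ] (Fin 2 → (adelicDatum F V).L2 μ) :=
    { toFun := fun f k => MemLp.toLp (CotangentForms.toQuotFun (adelicDatum F V) fun g => (f : (adelicDatum F V).Adelic → (Fin 2 → ℂ)) g k) (f.2 k)
      map_add' := fun f f' => by
        funext k
        exact MemLp.toLp_add (f.2 k) (f'.2 k)
      map_smul' := fun r f => by
        funext k
        exact MemLp.toLp_const_smul r (f.2 k) }
  obtain ⟨ℓ, hℓ⟩ := LinearMap.exists_extend L₀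
  refine ⟨ℓ, fun f hf k => ?_⟩
  have hfD : f ∈ D := fun k => memLp_toQuotFun F V hV hf k μ
  refine ⟨hfD k, ?_⟩
  have e : ℓ f = L₀ ⟨f, hfD⟩ := by
    have := LinearMap.congr_fun hℓ ⟨f, hfD⟩
    simpa using this
  rw [e]
  rfl

/-- **`Represents` for every automorphic measure (unfolded):** for every `f ∈ cohForms 𝔞₀` and coordinate `k`, the class `ℓ f k` has the continuous
representative `[h] ↦ f(h⁻¹) k` on the compact quotient. [cite: BorelJacquet1979, §4.2, §4.6] [cite: Borel1963, §5] -/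
theorem exists_linearMap_represents (hV : HodgeCM.IsAnisotropic F (HodgeCM.HermSpace3.Hm V))
    (μ : Measure (adelicDatum F V).automorphicQuotient) [(adelicDatum F V).IsAutomorphicMeasure μ] :
    ∃ ℓ : ((adelicDatum F V).Adelic → (Fin 2 → ℂ)) →ₗ[ℂ] (Fin 2 → (adelicDatum F V).L2 μ),
      ∀ f ∈ cohForms (archFactorOf F V), ∀ k : Fin 2, ∃ φ : ContinuousMap (adelicDatum F V).automorphicQuotient ℂ,
        (∀ h : (adelicDatum F V).Adelic, φ ((adelicDatum F V).toAutomorphicQuotient h) = f h⁻¹ k) ∧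
          ((ℓ f k : (adelicDatum F V).L2 μ) : (adelicDatum F V).automorphicQuotient → ℂ) =ᵐ[μ] ⇑φ := by
  obtain ⟨ℓ, hℓ⟩ := exists_linearMap_toLp F V hV μ
  refine ⟨ℓ, fun f hf k => ?_⟩
  obtain ⟨hm, hk⟩ := hℓ f hf k
  refine ⟨⟨CotangentForms.toQuotFun (adelicDatum F V) fun g => f g k, continuous_toQuotFun F V hf k⟩,
    fun h => toQuotFun_toAutomorphicQuotient F V hf k h, ?_⟩
  rw [hk]
  exact MemLp.coeFn_toLp hm

/-- **STUB U2ℓ (`StubU2lL2Realisation`), unfolded and binder-minimal: for `4 ≤ [F:ℚ]` there are an automorphic measure `μ` on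
`U(V)(F⁺)\U(V)(𝔸_{F⁺})` and a linear `ℓ : X →ₗ[ℂ] (Fin 2 → L²(μ))` which `Represents` the cohomological cotangent forms of the factor of record.**
The face's fold is `fun hDel F _ h6 _ V a₀ Φ hΦ i => exists_isAutomorphicMeasure_represents F (le_trans (by norm_num) h6) V` (by `rfl`-unfolding of
`Represents`/`quotMk`). [cite: BorelJacquet1979, §4.2, §4.6] [cite: Borel1963, §5] [cite: PlatonovRapinchuk1994, Thm. 5.5] -/
theorem exists_isAutomorphicMeasure_represents (h4 : 4 ≤ Module.finrank ℚ F) :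
    ∃ (μ : Measure (adelicDatum F V).automorphicQuotient) (_ : (adelicDatum F V).IsAutomorphicMeasure μ)
      (ℓ : ((adelicDatum F V).Adelic → (Fin 2 → ℂ)) →ₗ[ℂ] (Fin 2 → (adelicDatum F V).L2 μ)),
      ∀ f ∈ cohForms (archFactorOf F V), ∀ k : Fin 2, ∃ φ : ContinuousMap (adelicDatum F V).automorphicQuotient ℂ,
        (∀ h : (adelicDatum F V).Adelic, φ ((adelicDatum F V).toAutomorphicQuotient h) = f h⁻¹ k) ∧
          ((ℓ f k : (adelicDatum F V).L2 μ) : (adelicDatum F V).automorphicQuotient → ℂ) =ᵐ[μ] ⇑φ := by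
  have hV : HodgeCM.IsAnisotropic F (HodgeCM.HermSpace3.Hm V) := HodgeCM.HermSpace3.isAnisotropic V h4
  obtain ⟨μ, hμ⟩ := exists_isAutomorphicMeasure_cmDatum (HodgeCM.CMField.K F) 3 (HodgeCM.HermSpace3.Hm V) hV
  haveI : (adelicDatum F V).IsAutomorphicMeasure μ := hμ
  obtain ⟨ℓ, hℓ⟩ := exists_linearMap_represents F V hV μ
  exact ⟨μ, hμ, ℓ, hℓ⟩

end Summit.HodgeConjecture.HodgeConjecture.Cruxes.H413.P2StubU2lL2Realisation

end
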